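import Mathlib.Analysis.LocallyConvex.Separation
import Mathlib.Analysis.InnerProductSpace.Dual
import Literature.Geometry.Lorentzian.KerrConvergence
import Literature.Geometry.Lorentzian.KerrWaveDecay
import Literature.Geometry.Lorentzian.KerrWaveEnergy
import Literature.Geometry.Lorentzian.KerrHyperboloidalFlux
import Summits.FinalStateConjecture.FinalStateConjecture.Theorems.BartnikGapSettlingGapExhaustionKerrRadiusSublevelConvex
import HarnessLib

/-!
# Stub `stub_holeCone` of line `birth` of crux `ClusterCompleteness.OmegaLimitMultiKerr`
# (stmt-FinalStateConjecture-17639): outward cones at every point of a boosted Kerr exterior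

Crux `OmegaLimitMultiKerr` (route `ClusterCompleteness`, summit `FinalStateConjecture`), line
`registered` (`Cruxes/OmegaLimitMultiKerr/Lines/birth.lean`), stub 2c of the ORDER UPGRADE
`TameRecursO k 𝒟 → RecursO k 𝒟` (sup-norm interpolation on truncated `60°`-cones
`K(x, L) = x + {w | ‖w‖ ≤ L, ‖w‖ ≤ 2⟪w, u⟫}`).  Near the horizon boundary `{r = r₊}` of a hole
chart's domain — the boosted Kerr exterior `boostedKerrExterior Λ c M a`, an OPEN subset of `E4` —
balls of a uniform radius do not fit, but outward cones of a UNIFORM length do.  This file proves: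
for every motion `(Λ, c)` and sub-extremal `(M, a)` there is `L > 0` such that every point `x` of
the boosted exterior carries a unit direction `u` with

* the whole truncated cone `K(x, L)` inside the boosted exterior;
* the rest-frame chart time `t*(y) = (Λ⁻¹(y − c))⁰` moving by at most `1/2` along it;
* the rest-frame Kerr–Schild radius growing by at most `|a| + 1` along it.

Proof.  Put `Λ⁻¹ : E4 →L[ℝ] E4` and `L = 1 / (2 (‖Λ⁻¹‖ + 1))`, so that `‖Λ⁻¹ w‖ ≤ 1/2` for
`‖w‖ ≤ L`; the inverse Poincaré map is affine, `Λ⁻¹((x + w) − c) = Λ⁻¹(x − c) + Λ⁻¹ w`.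
(1) Time: `t*(x + w) − t*(x) = (Λ⁻¹ w)⁰`, a coordinate bounded by the Euclidean norm.
(2) Radius: `r ≤ ‖y⃗‖` (`Kerr.radius_le_spatialNorm`) and `‖y⃗‖² − a² ≤ r²`
(`Kerr.spatialNorm_sq_sub_sq_le_radius_sq`), so `r(p + v) ≤ ‖p⃗‖ + ‖v‖ ≤ r(p) + |a| + 1/2`.
(3) Exterior (the geometric heart): the black-hole column
`S = {y | r(Λ⁻¹(y − c)) ≤ r₊}` is closed (continuity of `r`) and CONVEX — an affine preimage of the
sublevel set `{r ≤ r₊}`, a solid confocal ellipsoid times the time axis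
(`Theorems.stub_kerrRadius_sublevel_convex`; O'Neill 1995, Ch. 2, §2.1: the level sets of the
Kerr–Schild radius are the confocal ellipsoids `(x² + y²)/(r² + a²) + z²/r² = 1`) — and `x ∉ S`
(`r₊ > 0` for sub-extremal parameters).  The geometric Hahn–Banach theorem strictly separates `x`
from `S` by a functional `f = ⟪n, ·⟫`; with `u = n/‖n‖` every `w` with `⟪w, u⟫ ≥ 0` has
`f(x + w) ≥ f(x) > sup_S f`, so `x + w ∉ S`, i.e. `x + w` lies in the boosted exterior (no bound on
`‖w‖` is needed for this part; if `n = 0` then `S = ∅` and any unit vector works).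

References: O'Neill, *The geometry of Kerr black holes* (1995), Ch. 2, §2.1; Visser
arXiv:0706.0622, (35).  No named facts; no definitions.
-/

-- D-0017: single-problem summit, `Summit.<S>.<S>.…` by design (the doubled path component trips dupNamespace)
set_option linter.dupNamespace false

noncomputable section

open scoped Manifold ContDiff Topology
open Set

namespace Summit.FinalStateConjecture.FinalStateConjecture.Theorems.ClusterCompleteness

open Literature.Geometry.Lorentzian
open Summit.FinalStateConjecture.FinalStateConjecture.Theorems (stub_kerrRadius_sublevel_convex)

/-- Each coordinate of a point of `E4` is bounded by its Euclidean norm. [folklore] -/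
private theorem holeCone_abs_apply_le_norm (y : E4) (μ : Fin 4) : |y μ| ≤ ‖y‖ := by
  have h := PiLp.norm_apply_le y μ
  rwa [Real.norm_eq_abs] at h

/-- `‖y⃗‖ ≤ ‖y‖`: the spatial radius of a point of `E4` is bounded by its Euclidean norm
(`‖y‖² = (y⁰)² + ‖y⃗‖²`). [folklore] -/
private theorem holeCone_spatialNorm_le_norm (y : E4) : E4.spatialNorm y ≤ ‖y‖ := by
  have hs : 0 ≤ E4.spatialNorm y := E4.spatialNorm_nonneg y
  have hsq : ‖y‖ ^ 2 = y 0 ^ 2 + E4.spatialNorm y ^ 2 := by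
    rw [EuclideanSpace.real_norm_sq_eq, Fin.sum_univ_four, E4.spatialNorm_sq]
    ring
  rw [← sq_le_sq₀ hs (norm_nonneg y), hsq]
  exact le_add_of_nonneg_left (sq_nonneg _)

/-- `‖p⃗‖ ≤ r + |a|` for the Kerr–Schild radius `r = Kerr.radius a p`: from `‖p⃗‖² − a² ≤ r²`
(Visser arXiv:0706.0622, (35)) and `r, |a| ≥ 0`. [folklore] -/
private theorem holeCone_spatialNorm_le_radius_add (a : ℝ) (p : E4) :
    E4.spatialNorm p ≤ Kerr.radius a p + |a| := by
  have h := Kerr.spatialNorm_sq_sub_sq_le_radius_sq a p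
  have hr := Kerr.radius_nonneg a p
  have ha := abs_nonneg a
  have hs := E4.spatialNorm_nonneg p
  rw [← sq_le_sq₀ hs (add_nonneg hr ha)]
  nlinarith [sq_abs a, mul_nonneg hr ha]

/-- The inverse Poincaré map is affine with linear part `Λ⁻¹`:
`Λ⁻¹((x + w) − c) = Λ⁻¹(x − c) + Λ⁻¹ w`. [folklore] -/
private theorem holeCone_poincareInv_add (Λ : lorentzGroup) (c x w : E4) :
    poincareInv Λ c (x + w) = poincareInv Λ c x + (Λ : E4 ≃L[ℝ] E4).symm w := by
  simp only [poincareInv, add_sub_right_comm, map_add]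

/-- **The geometric heart.** At every point `x` of the boosted sub-extremal Kerr exterior there is
a unit vector `u` such that `x + w` stays in the boosted exterior for EVERY `w` with `⟪w, u⟫ ≥ 0`:
the black-hole column `{y | r(Λ⁻¹(y − c)) ≤ r₊}` is closed and convex (an affine preimage of the
solid confocal ellipsoid `{r ≤ r₊}` times the time axis, O'Neill 1995, Ch. 2, §2.1), it misses `x`,
and a strictly separating functional (geometric Hahn–Banach) supplies the half-space. [folklore] -/
private theorem holeCone_exists_unit_halfspace {Λ : lorentzGroup} {c : E4} {M a : ℝ}
    (hMa : Kerr.IsSubextremal M a) {x : E4} (hx : x ∈ (boostedKerrExterior Λ c M a : Set E4)) :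
    ∃ u : E4, ‖u‖ = 1 ∧ ∀ w : E4, 0 ≤ inner ℝ w u →
      x + w ∈ (boostedKerrExterior Λ c M a : Set E4) := by
  have hr : 0 < Kerr.rPlus M a := hMa.rPlus_pos
  -- the black-hole column in lab coordinates
  set S : Set E4 := {y | Kerr.radius a (poincareInv Λ c y) ≤ Kerr.rPlus M a} with hS
  have hmem : ∀ y : E4, y ∈ (boostedKerrExterior Λ c M a : Set E4) ↔ y ∉ S := fun y => by
    simp only [SetLike.mem_coe, mem_boostedKerrExterior, Kerr.mem_exterior, max_eq_left hr.le,
      hS, mem_setOf_eq, not_le]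
  have hSclosed : IsClosed S :=
    isClosed_le ((Kerr.continuous_radius a).comp (continuous_poincareInv Λ c)) continuous_const
  have hSconv : Convex ℝ S := by
    intro y hy z hz p q hp hq hpq
    simp only [hS, mem_setOf_eq] at hy hz ⊢
    have key : poincareInv Λ c (p • y + q • z) =
        p • poincareInv Λ c y + q • poincareInv Λ c z := by
      simp only [poincareInv, ← map_smul, ← map_add]
      congr 1
      rw [smul_sub, smul_sub, sub_add_sub_comm, ← add_smul, hpq, one_smul]
    rw [key]
    exact (stub_kerrRadius_sublevel_convex a _ hr).2 hy hz hp hq hpq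
  obtain ⟨f, s, hfS, hfx⟩ := geometric_hahn_banach_closed_point hSconv hSclosed ((hmem x).1 hx)
  -- represent the separating functional by a vector
  obtain ⟨n, hf⟩ : ∃ n : E4, ∀ y : E4, f y = inner ℝ n y :=
    ⟨(InnerProductSpace.toDual ℝ E4).symm f, fun y => InnerProductSpace.toDual_symm_apply.symm⟩
  -- a unit vector `u` with `⟪w, u⟫ ≥ 0 → f w ≥ 0`
  obtain ⟨u, hu, hfu⟩ : ∃ u : E4, ‖u‖ = 1 ∧ ∀ w : E4, 0 ≤ inner ℝ w u → 0 ≤ f w := by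
    rcases eq_or_ne n 0 with h0 | h0
    · refine ⟨EuclideanSpace.single 0 1, by simp, fun w _ => ?_⟩
      rw [hf, h0, inner_zero_left]
    · refine ⟨(‖n‖⁻¹ : ℝ) • n, norm_smul_inv_norm h0, fun w hw => ?_⟩
      rw [real_inner_smul_right, real_inner_comm n w] at hw
      rw [hf]
      exact (mul_nonneg_iff_of_pos_left (inv_pos.2 (norm_pos_iff.2 h0))).1 hw
  refine ⟨u, hu, fun w hw => (hmem _).2 fun hxw => ?_⟩
  have h1 := hfS _ hxw
  rw [map_add] at h1
  linarith [hfu w hw]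

/-- **Stub 2c (`stub_holeCone`): outward cones at every point of a boosted Kerr exterior.** For
every motion `(Λ, c)` and sub-extremal `(M, a)` there is `L > 0` such that every point `x` of
`boostedKerrExterior Λ c M a` admits a unit vector `u` whose truncated cone
`x + {w | ‖w‖ ≤ L, ‖w‖ ≤ 2⟪w, u⟫}` stays in the boosted exterior, with rest-frame chart time
`t*(x + w)` within `1/2` of `t*(x)` and Kerr–Schild radius `r(x + w) ≤ r(x) + |a| + 1`.
The closed complement `{r ≤ r₊}` of the rest-frame exterior is convex — a solid confocal ellipsoid
times the time axis (`Theorems.stub_kerrRadius_sublevel_convex`; O'Neill 1995, Ch. 2, §2.1: the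
level sets of the Kerr–Schild radius are confocal ellipsoids) — so the pull-back by the affine
inverse Poincaré map of a strictly separating half-space of directions never re-enters it;
`r ≤ ‖x⃗‖ ≤ r + |a|` (`Kerr.radius_le_spatialNorm`, `Kerr.spatialNorm_sq_sub_sq_le_radius_sq`);
`|Δt*| ≤ ‖Λ⁻¹ w‖ ≤ ‖Λ⁻¹‖ ‖w‖ ≤ 1/2` for `L = 1 / (2 (‖Λ⁻¹‖ + 1))`. [folklore] -/
theorem stub_holeCone :
    ∀ (Λ : lorentzGroup) (c : E4) (M a : ℝ), Kerr.IsSubextremal M a → ∃ L : ℝ, 0 < L ∧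
      ∀ x ∈ (boostedKerrExterior Λ c M a : Set E4), ∃ u : E4, ‖u‖ = 1 ∧
        ∀ w : E4, ‖w‖ ≤ L → ‖w‖ ≤ 2 * inner ℝ w u →
          x + w ∈ (boostedKerrExterior Λ c M a : Set E4) ∧
          |(boostedKerrBackground Λ c M a).time (x + w) -
              (boostedKerrBackground Λ c M a).time x| ≤ 1 / 2 ∧
          (boostedKerrBackground Λ c M a).radius (x + w) ≤
            (boostedKerrBackground Λ c M a).radius x + (|a| + 1) := by
  intro Λ c M a hMa
  -- the linear part `Λ⁻¹` of the inverse Poincaré map, as a continuous linear map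
  obtain ⟨A, hA⟩ : ∃ A : E4 →L[ℝ] E4, ∀ v : E4, A v = (Λ : E4 ≃L[ℝ] E4).symm v :=
    ⟨((Λ : E4 ≃L[ℝ] E4).symm : E4 →L[ℝ] E4), fun v => rfl⟩
  have hK : 0 ≤ ‖A‖ := norm_nonneg A
  refine ⟨1 / (2 * (‖A‖ + 1)), by positivity, fun x hx => ?_⟩
  obtain ⟨u, hu, hcone⟩ := holeCone_exists_unit_halfspace hMa hx
  refine ⟨u, hu, fun w hwL hwu => ?_⟩
  -- the cone condition gives `⟪w, u⟫ ≥ 0`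
  have hw0 : 0 ≤ inner ℝ w u := by linarith [norm_nonneg w]
  -- the rest-frame displacement `Λ⁻¹ w` is short
  have hAw : ‖(Λ : E4 ≃L[ℝ] E4).symm w‖ ≤ 1 / 2 := by
    have h1 : ‖(Λ : E4 ≃L[ℝ] E4).symm w‖ ≤ ‖A‖ * ‖w‖ := by
      rw [← hA]
      exact A.le_opNorm w
    have h2 : ‖A‖ * ‖w‖ ≤ ‖A‖ * (1 / (2 * (‖A‖ + 1))) := mul_le_mul_of_nonneg_left hwL hK
    have h3 : ‖A‖ * (1 / (2 * (‖A‖ + 1))) ≤ 1 / 2 := by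
      rw [mul_one_div, div_le_iff₀ (by positivity : (0 : ℝ) < 2 * (‖A‖ + 1))]
      linarith
    linarith
  refine ⟨hcone w hw0, ?_, ?_⟩
  · -- time: `t*(x + w) − t*(x) = (Λ⁻¹ w)⁰`
    change |poincareInv Λ c (x + w) 0 - poincareInv Λ c x 0| ≤ 1 / 2
    rw [holeCone_poincareInv_add, PiLp.add_apply, add_sub_cancel_left]
    exact (holeCone_abs_apply_le_norm _ 0).trans hAw
  · -- radius: `r(p + v) ≤ ‖p⃗ + v⃗‖ ≤ ‖p⃗‖ + ‖v‖ ≤ r(p) + |a| + 1/2`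
    change Kerr.radius a (poincareInv Λ c (x + w)) ≤
      Kerr.radius a (poincareInv Λ c x) + (|a| + 1)
    rw [holeCone_poincareInv_add]
    have hsub : E4.spatialNorm (poincareInv Λ c x + (Λ : E4 ≃L[ℝ] E4).symm w) ≤
        E4.spatialNorm (poincareInv Λ c x) + E4.spatialNorm ((Λ : E4 ≃L[ℝ] E4).symm w) := by
      unfold E4.spatialNorm
      rw [map_add]
      exact norm_add_le _ _
    linarith [Kerr.radius_le_spatialNorm a (poincareInv Λ c x + (Λ : E4 ≃L[ℝ] E4).symm w),
      holeCone_spatialNorm_le_radius_add a (poincareInv Λ c x),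
      holeCone_spatialNorm_le_norm ((Λ : E4 ≃L[ℝ] E4).symm w)]

end Summit.FinalStateConjecture.FinalStateConjecture.Theorems.ClusterCompleteness

end
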